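import Summits.Ventures.YMGap.RobustBall.LocalSourceMassGap
import Summits.Ventures.YMGap.RobustBall.LocalSourceResponseBall
import Summits.Ventures.YMGap.RobustBall.LocalSourceAnalytic
import Summits.Ventures.YMGap.RobustBall.UniformRateStrongCoupling
import HarnessLib

/-!
# Venture YMGap, track ROBUST-BALL (Y2) — UNIFORMLY ON THE WEIGHTED (TIER-2, INFINITE-RANGE) BALL: every member plus ONE MORE LOOP OF
# ANY STRENGTH has a `C¹`/real-analytic response, an exponentially small susceptibility and a mass gap at least `m/2`

HONEST FRAMING. WHAT THIS IS: a venture file (cell `pub-ymgap`, track Y2 ROBUST-BALL, seat rb-p1, theorems only): the local-source package read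
UNIFORMLY on the most general ball of the lane, the weighted seminorm ball `MemBallZdS a Λ t` of link-summable perturbations (continuous own-link
terms, any number, any range; summable specification `perturbedYMS`) of a uniform tier-2 row `UniformMassGapOnBallZdS d N β a Λ t m A` —
answering rb-ref RB-361's «missed strength» (the Wilson file used the zero member only).  For EVERY member `W` and ONE closed walk `w₀`
with ANY real coupling `t`:
* `weightedBall_singleLoop_hasDerivAt_of_uniform` — `ν 0 ∈ 𝒢_S(W)` and `d/dt ∫F dν_t = −cov_{ν_t}(F, Re tr U_{w₀}/N)` on `ℝ` for every selection
  `ν t ∈ 𝒢_S(W + t·Re tr U_{w₀}/N)` and bounded measurable `F`; `weightedBall_singleLoop_analyticAt_of_uniform` — real-analytic on `ℝ`;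
* `weightedBall_singleLoop_susceptibility_le_of_uniform` — `|d/dt|_{0}∫F dν_t| ≤ A n² e^{−m d(Λ_F, w₀)} (K_F √N|w₀| + ‖F‖₂‖Re tr U_{w₀}/N‖₂)`;
* `weightedBall_singleLoop_massGap_of_uniform` — every DLR state of `W + t·Re tr U_{w₀}/N` clusters between ANY two Lipschitz cylinders at
  rate `m/2`, constant `A n² e^{2|t|} e^{m|w₀|} (…)` (`A ≥ 1`);
instantiated on the hypothesis-free rate rows of `UniformRateStrongCoupling.lean`: EVERY `N ≥ 2` at 't Hooft `0 < β < 1/64` on the weighted ball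
`MemBallZdS (1/20) (1/20) (log(1/(64β)))` (rate `log(1/(64β))`, constant `8N`): `suN_weightedBall_singleLoop_hasDerivAt / _analyticAt / _massGap`;
and `SU(2)` at `0 < β_W < 1/8` on `MemBallZdS a Λ (log(1/(8β_W)))` whenever `¾e^{a} + e^{a/2}√(2/3)Λ < 1` (rate `log(1/(8β_W))`, constant `16`):
`su2_weightedBall_singleLoop_massGap`.  (One state: `LocalSourceOneStateS.hasUniqueGibbsMeasure_add_of_uniformMassGapOnBallZdS`.)
WHAT THIS IS NOT: rates are comparison lower bounds; `m/2` is bookkeeping; lattice strong coupling; nothing about the continuum limit or a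
Clay-sense mass gap.
-/

noncomputable section

open MeasureTheory Function Finset Real ProbabilityTheory
open scoped NNReal
open Literature.Probability.LatticeModels
open Literature.MathematicalPhysics.QuantumLattice
open Literature.MathematicalPhysics.QuantumFieldTheory hiding ZdEdge Site

namespace Summit.Ventures.YMGap.RobustBall

variable {d N : ℕ}

section Generic

variable {β a Λ tw m A : ℝ} {W : Potential (ZdEdge d) (SUN N)}

/-- The tier-2 data of the one-loop source with coupling `t`: continuity, own-link dependence, support family and catalogue. -/
private theorem singleLoopW_data {x : Literature.Probability.LatticeModels.Site d} (w₀ : (zdGraph d).Walk x x) (t : ℝ) :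
    (∀ X, Continuous (loopFamilyAction (d := d) N (fun _ : Unit => (⟨x, w₀⟩ : ZdLoop d)) (fun _ => t) X)) ∧
    (∀ X, DependsOn (loopFamilyAction (d := d) N (fun _ : Unit => (⟨x, w₀⟩ : ZdLoop d)) (fun _ => t) X) (↑X : Set (ZdEdge d))) ∧
    (loopFamilyAction (d := d) N (fun _ : Unit => (⟨x, w₀⟩ : ZdLoop d)) fun _ => t).IsSupportedBy
      (loopSupp (fun _ : Unit => (⟨x, w₀⟩ : ZdLoop d))) ∧
    (∀ Λ, loopSupp (fun _ : Unit => (⟨x, w₀⟩ : ZdLoop d)) Λ ⊆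
      (Finset.univ : Finset Unit).image fun i => walkEdges ((fun _ : Unit => (⟨x, w₀⟩ : ZdLoop d)) i).walk) := by
  classical
  have hV := memBallZd_loopFamilyAction_fintype (N := N) (fun _ : Unit => (⟨x, w₀⟩ : ZdLoop d)) fun _ => t
  exact ⟨hV.continuous, hV.dependsOn, hV.supportedBy, fun Λ => Finset.image_subset_image (Finset.subset_univ _)⟩

/-- The catalogue of the one-loop source is `{links of w₀}`. -/
private theorem singleLoopW_image {x : Literature.Probability.LatticeModels.Site d} (w₀ : (zdGraph d).Walk x x) :
    (Finset.univ : Finset Unit).image (fun i => walkEdges ((fun _ : Unit => (⟨x, w₀⟩ : ZdLoop d)) i).walk) = {walkEdges w₀} := by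
  classical
  ext X
  simp only [Finset.mem_image, Finset.mem_univ, true_and, Finset.mem_singleton]
  exact ⟨fun ⟨_, h⟩ => h.symm, fun h => ⟨(), h.symm⟩⟩

/-- The family `t ↦ member + loop with coupling t` is `W + t • V₁`. -/
private theorem weightedBall_family (x : Literature.Probability.LatticeModels.Site d) (w₀ : (zdGraph d).Walk x x) (t : ℝ) :
    W + loopFamilyAction (d := d) N (fun _ : Unit => (⟨x, w₀⟩ : ZdLoop d)) (fun _ => t) =
      W + t • loopFamilyAction (d := d) N (fun _ : Unit => (⟨x, w₀⟩ : ZdLoop d)) fun _ => (1 : ℝ) := by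
  rw [← loopFamilyAction_smul]
  simp only [mul_one]

/-- **FEYNMAN–HELLMANN UNIFORMLY ON THE WEIGHTED BALL.** For a uniform tier-2 row `UniformMassGapOnBallZdS d N β a Λ t m A`, every member
`W ∈ MemBallZdS a Λ t` (continuous own-link terms, possibly infinitely many, of any range, inside the weighted seminorm ball), one more closed walk `w₀`, every selection `ν t` of DLR states of the member plus
`t · Re tr U_{w₀}/N`, and every bounded measurable `F`: `ν 0` is a DLR state of the member and
`d/dt ∫ F dν_t |_{t=b} = −cov_{ν_b}(F, Re tr U_{w₀}/N)` at every real `b`. -/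
theorem weightedBall_singleLoop_hasDerivAt_of_uniform (hrow : UniformMassGapOnBallZdS d N β a Λ tw m A) (hW : MemBallZdS a Λ tw W)
    {x : Literature.Probability.LatticeModels.Site d} (w₀ : (zdGraph d).Walk x x)
    {ν : ℝ → Measure (LGConfig d (SUN N))}
    (hν : ∀ t, ν t ∈ perturbedGibbsMeasuresS (d := d) (fundamentalRep (Fin N)) (N * β)
      (W + loopFamilyAction (d := d) N (fun _ : Unit => (⟨x, w₀⟩ : ZdLoop d)) (fun _ => t)))
    {F : LGConfig d (SUN N) → ℝ} (hFm : Measurable F) {C : ℝ} (hFb : ∀ U, |F U| ≤ C) (b : ℝ) :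
    ν 0 ∈ perturbedGibbsMeasuresS (d := d) (fundamentalRep (Fin N)) (N * β) W ∧
      HasDerivAt (fun t => ∫ U, F U ∂(ν t)) (-cov[F, loopTerm (d := d) N 1 w₀; ν b]) b := by
  classical
  obtain ⟨hVc, hVdep, hVs, hT⟩ := singleLoopW_data (N := N) w₀ (1 : ℝ)
  have hν' : ∀ t, ν t ∈ perturbedGibbsMeasuresS (d := d) (fundamentalRep (Fin N)) (N * β)
      (W + t • loopFamilyAction (d := d) N (fun _ : Unit => (⟨x, w₀⟩ : ZdLoop d)) fun _ => (1 : ℝ)) := by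
    intro t
    rw [← weightedBall_family x w₀ t]
    exact hν t
  obtain ⟨h0, -, hder⟩ := hasDerivAt_integral_of_uniformMassGapOnBallZdS hrow hW hVc hVdep hVs hT hν' hFm hFb b
  have hH : (fun U : LGConfig d (SUN N) => ∑ A ∈ (Finset.univ : Finset Unit).image
      (fun i => walkEdges ((fun _ : Unit => (⟨x, w₀⟩ : ZdLoop d)) i).walk),
      loopFamilyAction (d := d) N (fun _ : Unit => (⟨x, w₀⟩ : ZdLoop d)) (fun _ => (1 : ℝ)) A U) = loopTerm (d := d) N 1 w₀ :=
    funext fun U => sum_singleLoop_source w₀ U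
  rw [hH] at hder
  exact ⟨h0, hder⟩

/-- **REAL-ANALYTICITY UNIFORMLY ON THE WEIGHTED BALL**: `t ↦ ∫ F dν_t` is real-analytic at every `t₀ ∈ ℝ`. -/
theorem weightedBall_singleLoop_analyticAt_of_uniform (hrow : UniformMassGapOnBallZdS d N β a Λ tw m A) (hW : MemBallZdS a Λ tw W)
    {x : Literature.Probability.LatticeModels.Site d} (w₀ : (zdGraph d).Walk x x)
    {ν : ℝ → Measure (LGConfig d (SUN N))}
    (hν : ∀ t, ν t ∈ perturbedGibbsMeasuresS (d := d) (fundamentalRep (Fin N)) (N * β)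
      (W + loopFamilyAction (d := d) N (fun _ : Unit => (⟨x, w₀⟩ : ZdLoop d)) (fun _ => t)))
    {F : LGConfig d (SUN N) → ℝ} (hFm : Measurable F) {C : ℝ} (hFb : ∀ U, |F U| ≤ C) (t₀ : ℝ) :
    AnalyticAt ℝ (fun t => ∫ U, F U ∂(ν t)) t₀ := by
  classical
  obtain ⟨hVc, hVdep, hVs, hT⟩ := singleLoopW_data (N := N) w₀ (1 : ℝ)
  have hν' : ∀ t, ν t ∈ perturbedGibbsMeasuresS (d := d) (fundamentalRep (Fin N)) (N * β)
      (W + t • loopFamilyAction (d := d) N (fun _ : Unit => (⟨x, w₀⟩ : ZdLoop d)) fun _ => (1 : ℝ)) := by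
    intro t
    rw [← weightedBall_family x w₀ t]
    exact hν t
  exact analyticAt_integral_of_uniformMassGapOnBallZdS hrow hW hVc hVdep hVs hT hν' hFm hFb t₀

/-- **THE SUSCEPTIBILITY TO ONE MORE LOOP IS EXPONENTIALLY SMALL IN THE SEPARATION, UNIFORMLY ON THE WEIGHTED BALL**: for every member, every
selection `ν t`, and every Lipschitz cylinder `F` on `Λ_F` disjoint from the links of `w₀` (`|Λ_F|, |links w₀| ≤ n`):
`|d/dt|_{t=0} ∫ F dν_t| ≤ A n² e^{−m d(Λ_F, w₀)} (K_F · √N |w₀| + ‖F‖₂ ‖Re tr U_{w₀}/N‖₂)` (norms in the member's state `ν 0`). -/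
theorem weightedBall_singleLoop_susceptibility_le_of_uniform (hrow : UniformMassGapOnBallZdS d N β a Λ tw m A) (hW : MemBallZdS a Λ tw W)
    {x : Literature.Probability.LatticeModels.Site d} (w₀ : (zdGraph d).Walk x x)
    {ν : ℝ → Measure (LGConfig d (SUN N))}
    (hν : ∀ t, ν t ∈ perturbedGibbsMeasuresS (d := d) (fundamentalRep (Fin N)) (N * β)
      (W + loopFamilyAction (d := d) N (fun _ : Unit => (⟨x, w₀⟩ : ZdLoop d)) (fun _ => t)))
    {n : ℕ} {F : LGConfig d (SUN N) → ℝ} {ΛF : Finset (ZdEdge d)} {KF : ℝ≥0}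
    (hF : IsLipschitzCylinder (fundamentalRep (Fin N)) F ΛF KF) (hΛF : ΛF.card ≤ n) (hwn : (walkEdges w₀).card ≤ n)
    (hdisj : Disjoint ΛF (walkEdges w₀)) :
    ∃ χ : ℝ, HasDerivAt (fun t => ∫ U, F U ∂(ν t)) χ 0 ∧
      |χ| ≤ A * (n : ℝ) ^ 2 * Real.exp (-m * setDistEdges ΛF (walkEdges w₀)) *
        ((KF : ℝ) * (|(1 : ℝ)| * Real.sqrt N * w₀.length) +
          Real.sqrt (∫ U, F U ^ 2 ∂(ν 0)) * Real.sqrt (∫ U, loopTerm (d := d) N 1 w₀ U ^ 2 ∂(ν 0))) := by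
  classical
  obtain ⟨hVc, hVdep, hVs, hT⟩ := singleLoopW_data (N := N) w₀ (1 : ℝ)
  have hν' : ∀ t, ν t ∈ perturbedGibbsMeasuresS (d := d) (fundamentalRep (Fin N)) (N * β)
      (W + t • loopFamilyAction (d := d) N (fun _ : Unit => (⟨x, w₀⟩ : ZdLoop d)) fun _ => (1 : ℝ)) := by
    intro t
    rw [← weightedBall_family x w₀ t]
    exact hν t
  obtain ⟨h0, hcl, hder⟩ := hasDerivAt_integral_of_uniformMassGapOnBallZdS hrow hW hVc hVdep hVs hT hν' hF.measurable hF.abs_le 0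
  have himg := singleLoopW_image (d := d) w₀
  refine ⟨_, hder, ?_⟩
  rw [abs_neg, himg]
  set Kc : Finset (ZdEdge d) → ℝ≥0 := fun _ => ⟨|(1 : ℝ)| * Real.sqrt N * w₀.length, by positivity⟩ with hKc
  have hKcc : ∀ X, (Kc X : ℝ) = |(1 : ℝ)| * Real.sqrt N * w₀.length := fun X => by rw [hKc]; rfl
  have key := abs_cov_hamiltonian_le_of_perturbedClusteringS hcl h0 (n := n) hF hΛF
    (V := loopFamilyAction (d := d) N (fun _ : Unit => (⟨x, w₀⟩ : ZdLoop d)) fun _ => (1 : ℝ))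
    (T := ({walkEdges w₀} : Finset (Finset (ZdEdge d)))) (K := Kc) (fun X hX => by
      rw [Finset.mem_singleton] at hX
      subst hX
      rw [loopFamilyAction_single_apply]
      exact isLipschitzCylinder_loopTerm (N := N) 1 w₀)
    (fun X hX => by rw [Finset.mem_singleton] at hX; subst hX; exact hwn)
    (fun X hX => by rw [Finset.mem_singleton] at hX; subst hX; exact hdisj)
  rw [Finset.sum_singleton, loopFamilyAction_single_apply, hKcc (walkEdges w₀)] at key
  refine key.trans (le_of_eq ?_)
  ring

/-- ★ **THE MASS GAP SURVIVES ONE MORE LOOP OF ANY STRENGTH, UNIFORMLY ON THE WEIGHTED BALL** (`A ≥ 1`): for every member `W` and every DLR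
state `ν` of the member plus `t · Re tr U_{w₀}/N`, all Lipschitz cylinders `F`, `G` on disjoint link sets with
`|Λ_F ∪ links w₀|, |Λ_G ∪ links w₀| ≤ n`:
`|cov_ν(F, G)| ≤ A n² e^{2|t|} e^{m|w₀|} e^{−(m/2) d(Λ_F, Λ_G)} (K_F K_G + 2 (|t|√N|w₀|)(M_F K_G + M_G K_F) + 2 M_F M_G)`. -/
theorem weightedBall_singleLoop_massGap_of_uniform (hrow : UniformMassGapOnBallZdS d N β a Λ tw m A) (hA : 1 ≤ A)
    (hW : MemBallZdS a Λ tw W)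
    {x : Literature.Probability.LatticeModels.Site d} (w₀ : (zdGraph d).Walk x x) (t : ℝ)
    {ν : Measure (LGConfig d (SUN N))}
    (hν : ν ∈ perturbedGibbsMeasuresS (d := d) (fundamentalRep (Fin N)) (N * β)
      (W + loopFamilyAction (d := d) N (fun _ : Unit => (⟨x, w₀⟩ : ZdLoop d)) (fun _ => t)))
    {n : ℕ} {F G : LGConfig d (SUN N) → ℝ} {ΛF ΛG : Finset (ZdEdge d)} {KF KG MF MG : ℝ≥0}
    (hF : IsLipschitzCylinder (fundamentalRep (Fin N)) F ΛF KF) (hMF : ∀ U, |F U| ≤ MF)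
    (hG : IsLipschitzCylinder (fundamentalRep (Fin N)) G ΛG KG) (hMG : ∀ U, |G U| ≤ MG)
    (hn₁ : (ΛF ∪ walkEdges w₀).card ≤ n) (hn₂ : (ΛG ∪ walkEdges w₀).card ≤ n) (hdisj : Disjoint ΛF ΛG) :
    |cov[F, G; ν]| ≤ A * (n : ℝ) ^ 2 * exp (2 * |t|) * exp (m * (2 * w₀.length) / 2) *
        exp (-(m / 2) * setDistEdges ΛF ΛG) *
      ((KF : ℝ) * KG + 2 * (|t| * Real.sqrt N * w₀.length) * (MF * KG + MG * KF) + 2 * MF * MG) := by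
  classical
  obtain ⟨hVc, hVdep, hVs, hT⟩ := singleLoopW_data (N := N) w₀ t
  have himg := singleLoopW_image (d := d) w₀
  set Kc : Finset (ZdEdge d) → ℝ≥0 := fun _ => ⟨|t| * Real.sqrt N * w₀.length, by positivity⟩ with hKc
  have hKcc : ∀ X, (Kc X : ℝ) = |t| * Real.sqrt N * w₀.length := fun X => by rw [hKc]; rfl
  have hVL : ∀ X ∈ (Finset.univ : Finset Unit).image (fun i => walkEdges ((fun _ : Unit => (⟨x, w₀⟩ : ZdLoop d)) i).walk),
      IsLipschitzCylinder (fundamentalRep (Fin N)) (loopFamilyAction (d := d) N (fun _ : Unit => (⟨x, w₀⟩ : ZdLoop d)) (fun _ => t) X)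
        X (Kc X) := by
    intro X hX
    rw [himg, Finset.mem_singleton] at hX
    subst hX
    rw [loopFamilyAction_single_apply]
    exact isLipschitzCylinder_loopTerm (N := N) t w₀
  have hS : ∀ X ∈ (Finset.univ : Finset Unit).image (fun i => walkEdges ((fun _ : Unit => (⟨x, w₀⟩ : ZdLoop d)) i).walk),
      X ⊆ walkEdges w₀ := by
    intro X hX
    rw [himg, Finset.mem_singleton] at hX
    exact hX.le
  have hB : ∀ U, |∑ X ∈ (Finset.univ : Finset Unit).image (fun i => walkEdges ((fun _ : Unit => (⟨x, w₀⟩ : ZdLoop d)) i).walk),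
      loopFamilyAction (d := d) N (fun _ : Unit => (⟨x, w₀⟩ : ZdLoop d)) (fun _ => t) X U| ≤ |t| := by
    intro U
    rw [himg, Finset.sum_singleton, loopFamilyAction_single_apply]
    exact abs_loopTerm_le w₀ U
  have hδ : ∀ s ∈ walkEdges w₀, ∀ s' ∈ walkEdges w₀, ‖s.1 - s'.1‖ ≤ 2 * (w₀.length : ℝ) := fun s hs s' hs' =>
    norm_sub_le_two_mul_length_of_mem_walkEdges w₀ hs hs'
  have key := abs_cov_le_halfRate_of_uniformMassGapOnBallZdS_add hrow hA hW hVc hVdep hVs hT hVL hS hB (by positivity) hδ hν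
    hF hMF hG hMG hn₁ hn₂ hdisj
  have hsum : ((∑ X ∈ (Finset.univ : Finset Unit).image (fun i => walkEdges ((fun _ : Unit => (⟨x, w₀⟩ : ZdLoop d)) i).walk),
      Kc X : ℝ≥0) : ℝ) = |t| * Real.sqrt N * w₀.length := by
    rw [himg, Finset.sum_singleton]; exact hKcc (walkEdges w₀)
  rw [hsum] at key
  exact key

end Generic

/-! ### Every `N ≥ 2`, `d = 4`, 't Hooft `0 < β < 1/64`: the weighted ball `MemBallZdS (1/20) (1/20) (log(1/(64β)))`, rate `log(1/(64β))`, `8N` -/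

section SUN

variable {β : ℝ} {W : Potential (ZdEdge 4) (SUN N)}

/-- **Every `N ≥ 2`: Feynman–Hellmann for a member of the weighted ball plus one more loop of any strength.** -/
theorem suN_weightedBall_singleLoop_hasDerivAt (hN : 2 ≤ N) (h0 : 0 < β) (h : β < 1 / 64)
    (hW : MemBallZdS (1 / 20) (1 / 20) (Real.log (1 / (64 * β))) W)
    {x : Literature.Probability.LatticeModels.Site 4} (w₀ : (zdGraph 4).Walk x x)
    {ν : ℝ → Measure (LGConfig 4 (SUN N))}
    (hν : ∀ t, ν t ∈ perturbedGibbsMeasuresS (d := 4) (fundamentalRep (Fin N)) (N * β)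
      (W + loopFamilyAction (d := 4) N (fun _ : Unit => (⟨x, w₀⟩ : ZdLoop 4)) (fun _ => t)))
    {F : LGConfig 4 (SUN N) → ℝ} (hFm : Measurable F) {C : ℝ} (hFb : ∀ U, |F U| ≤ C) (b : ℝ) :
    HasDerivAt (fun t => ∫ U, F U ∂(ν t)) (-cov[F, loopTerm (d := 4) N 1 w₀; ν b]) b :=
  (weightedBall_singleLoop_hasDerivAt_of_uniform (suN_uniformBallZdS_rate hN h0 h) hW w₀ hν hFm hFb b).2

/-- **Every `N ≥ 2`: real-analytic response on the weighted ball.** -/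
theorem suN_weightedBall_singleLoop_analyticAt (hN : 2 ≤ N) (h0 : 0 < β) (h : β < 1 / 64)
    (hW : MemBallZdS (1 / 20) (1 / 20) (Real.log (1 / (64 * β))) W)
    {x : Literature.Probability.LatticeModels.Site 4} (w₀ : (zdGraph 4).Walk x x)
    {ν : ℝ → Measure (LGConfig 4 (SUN N))}
    (hν : ∀ t, ν t ∈ perturbedGibbsMeasuresS (d := 4) (fundamentalRep (Fin N)) (N * β)
      (W + loopFamilyAction (d := 4) N (fun _ : Unit => (⟨x, w₀⟩ : ZdLoop 4)) (fun _ => t)))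
    {F : LGConfig 4 (SUN N) → ℝ} (hFm : Measurable F) {C : ℝ} (hFb : ∀ U, |F U| ≤ C) (t₀ : ℝ) :
    AnalyticAt ℝ (fun t => ∫ U, F U ∂(ν t)) t₀ :=
  weightedBall_singleLoop_analyticAt_of_uniform (suN_uniformBallZdS_rate hN h0 h) hW w₀ hν hFm hFb t₀

/-- ★ **Every `N ≥ 2`: ONE MORE LOOP OF ANY STRENGTH DOES NOT CLOSE THE MASS GAP, UNIFORMLY ON THE WEIGHTED BALL**
`MemBallZdS (1/20) (1/20) (log(1/(64β)))` at 't Hooft `0 < β < 1/64`: rate `(1/2)log(1/(64β))`, constant `8N n² e^{2|t|} (64β)^{−|w₀|} (…)`. -/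
theorem suN_weightedBall_singleLoop_massGap (hN : 2 ≤ N) (h0 : 0 < β) (h : β < 1 / 64)
    (hW : MemBallZdS (1 / 20) (1 / 20) (Real.log (1 / (64 * β))) W)
    {x : Literature.Probability.LatticeModels.Site 4} (w₀ : (zdGraph 4).Walk x x) (t : ℝ)
    {ν : Measure (LGConfig 4 (SUN N))}
    (hν : ν ∈ perturbedGibbsMeasuresS (d := 4) (fundamentalRep (Fin N)) (N * β)
      (W + loopFamilyAction (d := 4) N (fun _ : Unit => (⟨x, w₀⟩ : ZdLoop 4)) (fun _ => t)))
    {n : ℕ} {F G : LGConfig 4 (SUN N) → ℝ} {ΛF ΛG : Finset (ZdEdge 4)} {KF KG MF MG : ℝ≥0}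
    (hF : IsLipschitzCylinder (fundamentalRep (Fin N)) F ΛF KF) (hMF : ∀ U, |F U| ≤ MF)
    (hG : IsLipschitzCylinder (fundamentalRep (Fin N)) G ΛG KG) (hMG : ∀ U, |G U| ≤ MG)
    (hn₁ : (ΛF ∪ walkEdges w₀).card ≤ n) (hn₂ : (ΛG ∪ walkEdges w₀).card ≤ n) (hdisj : Disjoint ΛF ΛG) :
    |cov[F, G; ν]| ≤ 8 * N * (n : ℝ) ^ 2 * exp (2 * |t|) * exp (Real.log (1 / (64 * β)) * (2 * w₀.length) / 2) *
        exp (-(Real.log (1 / (64 * β)) / 2) * setDistEdges ΛF ΛG) *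
      ((KF : ℝ) * KG + 2 * (|t| * Real.sqrt N * w₀.length) * (MF * KG + MG * KF) + 2 * MF * MG) := by
  have hA : (1 : ℝ) ≤ 8 * N := by
    have : (2 : ℝ) ≤ N := by exact_mod_cast hN
    linarith
  exact weightedBall_singleLoop_massGap_of_uniform (suN_uniformBallZdS_rate hN h0 h) hA hW w₀ t hν hF hMF hG hMG hn₁ hn₂ hdisj

end SUN

/-! ### `SU(2)`, `d = 4`, `0 < β_W < 1/8`: the weighted ball `MemBallZdS a Λ (log(1/(8β_W)))` with `¾e^{a} + e^{a/2}√(2/3)Λ < 1` -/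

section SU2

variable {βW a Λ : ℝ} {W : Potential (ZdEdge 4) (SUN 2)}

/-- ★ **`SU(2)`: ONE MORE LOOP OF ANY STRENGTH DOES NOT CLOSE THE MASS GAP, UNIFORMLY ON THE WEIGHTED BALL** `MemBallZdS a Λ (log(1/(8β_W)))`
(`0 < β_W < 1/8`, `¾e^{a} + e^{a/2}√(2/3)Λ < 1`): rate `(1/2)log(1/(8β_W))`, constant `16 n² e^{2|t|} (8β_W)^{−|w₀|} (…)`. -/
theorem su2_weightedBall_singleLoop_massGap (h0 : 0 < βW) (h : βW < 1 / 8)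
    (hρ : 3 / 4 * Real.exp a + Real.exp (a / 2) * Real.sqrt (2 / 3) * Λ < 1)
    (hW : MemBallZdS a Λ (Real.log (1 / (8 * βW))) W)
    {x : Literature.Probability.LatticeModels.Site 4} (w₀ : (zdGraph 4).Walk x x) (t : ℝ)
    {ν : Measure (LGConfig 4 (SUN 2))}
    (hν : ν ∈ perturbedGibbsMeasuresS (d := 4) (fundamentalRep (Fin 2)) (2 * (βW / 4))
      (W + loopFamilyAction (d := 4) 2 (fun _ : Unit => (⟨x, w₀⟩ : ZdLoop 4)) (fun _ => t)))
    {n : ℕ} {F G : LGConfig 4 (SUN 2) → ℝ} {ΛF ΛG : Finset (ZdEdge 4)} {KF KG MF MG : ℝ≥0}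
    (hF : IsLipschitzCylinder (fundamentalRep (Fin 2)) F ΛF KF) (hMF : ∀ U, |F U| ≤ MF)
    (hG : IsLipschitzCylinder (fundamentalRep (Fin 2)) G ΛG KG) (hMG : ∀ U, |G U| ≤ MG)
    (hn₁ : (ΛF ∪ walkEdges w₀).card ≤ n) (hn₂ : (ΛG ∪ walkEdges w₀).card ≤ n) (hdisj : Disjoint ΛF ΛG) :
    |cov[F, G; ν]| ≤ 16 * (n : ℝ) ^ 2 * exp (2 * |t|) * exp (Real.log (1 / (8 * βW)) * (2 * w₀.length) / 2) *
        exp (-(Real.log (1 / (8 * βW)) / 2) * setDistEdges ΛF ΛG) *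
      ((KF : ℝ) * KG + 2 * (|t| * Real.sqrt (2 : ℕ) * w₀.length) * (MF * KG + MG * KF) + 2 * MF * MG) :=
  weightedBall_singleLoop_massGap_of_uniform (su2_uniformBallZdS_rate h0 h hρ) (by norm_num) hW w₀ t hν hF hMF hG hMG hn₁ hn₂ hdisj

/-- **`SU(2)`: Feynman–Hellmann + real-analyticity on the same weighted ball.** -/
theorem su2_weightedBall_singleLoop_analyticAt (h0 : 0 < βW) (h : βW < 1 / 8)
    (hρ : 3 / 4 * Real.exp a + Real.exp (a / 2) * Real.sqrt (2 / 3) * Λ < 1)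
    (hW : MemBallZdS a Λ (Real.log (1 / (8 * βW))) W)
    {x : Literature.Probability.LatticeModels.Site 4} (w₀ : (zdGraph 4).Walk x x)
    {ν : ℝ → Measure (LGConfig 4 (SUN 2))}
    (hν : ∀ t, ν t ∈ perturbedGibbsMeasuresS (d := 4) (fundamentalRep (Fin 2)) (2 * (βW / 4))
      (W + loopFamilyAction (d := 4) 2 (fun _ : Unit => (⟨x, w₀⟩ : ZdLoop 4)) (fun _ => t)))
    {F : LGConfig 4 (SUN 2) → ℝ} (hFm : Measurable F) {C : ℝ} (hFb : ∀ U, |F U| ≤ C) (t₀ : ℝ) :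
    HasDerivAt (fun t => ∫ U, F U ∂(ν t)) (-cov[F, loopTerm (d := 4) 2 1 w₀; ν t₀]) t₀ ∧
      AnalyticAt ℝ (fun t => ∫ U, F U ∂(ν t)) t₀ :=
  ⟨(weightedBall_singleLoop_hasDerivAt_of_uniform (su2_uniformBallZdS_rate h0 h hρ) hW w₀ hν hFm hFb t₀).2,
    weightedBall_singleLoop_analyticAt_of_uniform (su2_uniformBallZdS_rate h0 h hρ) hW w₀ hν hFm hFb t₀⟩

end SU2

end Summit.Ventures.YMGap.RobustBall

end
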